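import Summits.Ventures.HSemireg.WedgeHankelRecurrenceGaussChebyshevSLiftingExponent
import Mathlib.Analysis.SpecialFunctions.Trigonometric.Chebyshev.RootsExtrema

/-!
# Venture HSemireg — **THE REAL ROOTS OF THE VIETA–LUCAS POLYNOMIALS: `(S ℝ n).roots = {2cos((k+1)π∕(n+1)) : k < n}` and `(C ℝ n).roots = {2cos((2k+1)π∕2n) : k < n}`**
# (all simple), the factorisations `S_n = ∏ (X − 2cos((k+1)π∕(n+1)))`, `C_n = ∏ (X − 2cos((2k+1)π∕2n))` over `ℝ`, and the root tests `S_n(x) = 0 ⇔ x = 2cos((k+1)π∕(n+1))`,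
# `C_n(x) = 0 ⇔ x = 2cos((2k+1)π∕2n)`

HONEST FRAMING. Part of the Lean index of the computation cell `pub-hsemireg` (seat p10 gen 49, Sunday typer «UNIFORM-IN-n»).  Real polynomial algebra and trigonometry only (Mathlib
`Polynomial.Chebyshev.S ∕ C`, `Polynomial.roots`, `Real.cos`); no variety, no cohomology theory, no sheaf, no Ext group and no semiregularity map is constructed here; nothing here says that
HC / HC_CM / HC_AV holds; no Literature fact (unproved `Prop`) is declared or used.  Custodian versions as in `WedgeHankelSiegelIdeal` (1/3).
SOURCES (cited).  T. J. Rivlin, *The Chebyshev Polynomials* (1974), §1.2 (zeros of `T_n`, `U_n`); G. Szegő, *Orthogonal Polynomials*, (1.12.3) and §6.3; the dilated («Vieta–Lucas ∕ Vieta–Fibonacci»)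
normalisation `C_n(2x) = 2T_n(x)`, `S_n(2x) = U_n(x)` is Mathlib's (`Polynomial.Chebyshev.C_comp_two_mul_X`, `S_comp_two_mul_X`); A. F. Horadam, Fibonacci Quart. 40 (2002) 223–232 (Vieta polynomials).
PROOF TYPED HERE.  Mathlib `S_two_mul_real_cos` ∕ `C_two_mul_real_cos` make every listed point a root; the points are pairwise distinct (`Real.injOn_cos` on `[0, π]`, as in Mathlib
`roots_U_real_nodup` ∕ `roots_T_real_nodup`, transported along `x ↦ 2x`); the degree count `deg S_n = n` (N465 `chebyshevS_natDegree_monic`), `deg C_n = n`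
(`Literature…ChebyshevChains.monic_chebyshevC_and_natDegree`) closes with Mathlib `roots_eq_of_degree_eq_card`; the products from `prod_multiset_X_sub_C_of_monic_of_roots_card_eq`.
DEDUP DISCLOSURE (`rg -n 'roots' Summits/Ventures/HSemireg/WedgeHankelRecurrenceGauss*`, `lean search roots_S`, 2026-09-04): Mathlib has `roots_T_real`, `roots_U_real` (and the `cos`
evaluations of `S`, `C`); N480 counts common `T ∕ U` nodes; the `S ∕ C` root multisets, multiplicities and real factorisations below are not in the tree; 0 hits for the 10 names below.

WHAT IS IN THE TREE.  Mathlib `roots_U_real(_nodup)`, `roots_T_real(_nodup)`, `S_two_mul_real_cos`, `C_two_mul_real_cos`; N465 `chebyshevS_natDegree_monic`.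
THIS FILE (namespace `Summit.Ventures.HSemireg.Wedge.HankelOuter` continued; CHAINED on N499; 0 definitions):
* §1265 `chebyshevS_roots_real_nodup`, **`chebyshevS_roots_real`**, `chebyshevS_rootMultiplicity_real`, **`chebyshevS_eval_eq_zero_iff_real`**, **`chebyshevS_eq_prod_real`**,
  `chebyshevC_roots_real_nodup`, **`chebyshevC_roots_real`**, `chebyshevC_rootMultiplicity_real`, **`chebyshevC_eval_eq_zero_iff_real`**, **`chebyshevC_eq_prod_real`**.
CAVEATS.  `n ∈ ℕ` (negative indices via `S_neg_sub_two`, `C_neg`); the product form of `C_n` needs `n ≠ 0` (`C_0 = 2`).  Nothing Ext-side.  New names only.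
-/

open Module Polynomial Real
open scoped Matrix Polynomial

namespace Summit.Ventures.HSemireg.Wedge.HankelOuter

/-! ## §1265. Real roots of `S_n` and `C_n` -/

/-- The points `2cos((k+1)π∕(n+1))`, `k < n`, are pairwise distinct. [Rivlin §1.2; this file, §1265] -/
theorem chebyshevS_roots_real_nodup (n : ℕ) :
    ((Multiset.range n).map fun k : ℕ => 2 * cos ((k + 1) * π / (n + 1))).Nodup := by
  have h := (Polynomial.Chebyshev.roots_U_real_nodup n).map (mul_right_injective₀ (two_ne_zero (α := ℝ)))
  rwa [Multiset.map_map] at h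

/-- **`(S ℝ n).roots = {2cos((k+1)π∕(n+1)) : k < n}`** (as a multiset: every root simple). [Rivlin §1.2 with `S_n(2x) = U_n(x)`; this file, §1265] -/
theorem chebyshevS_roots_real (n : ℕ) :
    (Polynomial.Chebyshev.S ℝ (n : ℤ)).roots = (Multiset.range n).map fun k : ℕ => 2 * cos ((k + 1) * π / (n + 1)) := by
  classical
  have hnd := chebyshevS_roots_real_nodup n
  have hfin : ((Multiset.range n).map fun k : ℕ => 2 * cos ((k + 1) * π / (n + 1))) =
      (((Multiset.range n).map fun k : ℕ => 2 * cos ((k + 1) * π / (n + 1))).toFinset).val := by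
    rw [Multiset.toFinset_val, Multiset.dedup_eq_self.mpr hnd]
  rw [hfin]
  refine roots_eq_of_degree_eq_card (fun x hx => ?_) ?_
  · obtain ⟨k, hk, rfl⟩ := Multiset.mem_map.mp (Multiset.mem_toFinset.mp hx)
    have hk : k < n := Multiset.mem_range.mp hk
    have hθpos : 0 < ((k : ℝ) + 1) * π / ((n : ℝ) + 1) := by positivity
    have hθlt : ((k : ℝ) + 1) * π / ((n : ℝ) + 1) < π := by
      rw [div_lt_iff₀ (by positivity)]
      have : ((k : ℝ) + 1) < (n : ℝ) + 1 := by exact_mod_cast Nat.succ_lt_succ hk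
      nlinarith [pi_pos]
    have hsin : sin (((k : ℝ) + 1) * π / ((n : ℝ) + 1)) ≠ 0 := (sin_pos_of_pos_of_lt_pi hθpos hθlt).ne'
    have h := Polynomial.Chebyshev.S_two_mul_real_cos (((k : ℝ) + 1) * π / ((n : ℝ) + 1)) (n : ℤ)
    rw [Int.cast_natCast, show ((n : ℝ) + 1) * (((k : ℝ) + 1) * π / ((n : ℝ) + 1)) = ((k + 1 : ℕ) : ℝ) * π by push_cast; field_simp,
      sin_nat_mul_pi] at h
    exact (mul_eq_zero.mp h).resolve_right hsin
  · rw [Multiset.card_toFinset, Multiset.dedup_eq_self.mpr hnd, Multiset.card_map, Multiset.card_range]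
    obtain ⟨hdeg, hmonic⟩ := chebyshevS_natDegree_monic (R := ℝ) n
    rw [degree_eq_natDegree hmonic.ne_zero, hdeg]

/-- Every real root of `S_n` is simple: `mult(2cos((k+1)π∕(n+1)), S_n) = 1` (`k < n`). [Rivlin §1.2; this file, §1265] -/
theorem chebyshevS_rootMultiplicity_real {n k : ℕ} (hk : k < n) :
    (Polynomial.Chebyshev.S ℝ (n : ℤ)).rootMultiplicity (2 * cos ((k + 1) * π / (n + 1))) = 1 := by
  rw [← count_roots, chebyshevS_roots_real]
  exact Multiset.count_eq_one_of_mem (chebyshevS_roots_real_nodup n) (Multiset.mem_map.mpr ⟨k, Multiset.mem_range.mpr hk, rfl⟩)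

/-- **Root test: `S_n(x) = 0 ⇔ x = 2cos((k+1)π∕(n+1))` for some `k < n`** (`x ∈ ℝ`). [Rivlin §1.2; this file, §1265] -/
theorem chebyshevS_eval_eq_zero_iff_real (n : ℕ) (x : ℝ) :
    (Polynomial.Chebyshev.S ℝ (n : ℤ)).eval x = 0 ↔ ∃ k < n, x = 2 * cos ((k + 1) * π / (n + 1)) := by
  have hne : Polynomial.Chebyshev.S ℝ (n : ℤ) ≠ 0 := (chebyshevS_natDegree_monic (R := ℝ) n).2.ne_zero
  rw [← Polynomial.IsRoot.def, ← mem_roots hne, chebyshevS_roots_real, Multiset.mem_map]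
  constructor
  · rintro ⟨k, hk, rfl⟩; exact ⟨k, Multiset.mem_range.mp hk, rfl⟩
  · rintro ⟨k, hk, rfl⟩; exact ⟨k, Multiset.mem_range.mpr hk, rfl⟩

/-- **`S_n = ∏_{k<n} (X − 2cos((k+1)π∕(n+1)))` over `ℝ`.** [Rivlin §1.2; Szegő (1.12.3); this file, §1265] -/
theorem chebyshevS_eq_prod_real (n : ℕ) :
    Polynomial.Chebyshev.S ℝ (n : ℤ) = ∏ k ∈ Finset.range n, (Polynomial.X - Polynomial.C (2 * cos ((k + 1) * π / (n + 1)))) := by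
  obtain ⟨hdeg, hmonic⟩ := chebyshevS_natDegree_monic (R := ℝ) n
  have h := prod_multiset_X_sub_C_of_monic_of_roots_card_eq hmonic (by rw [chebyshevS_roots_real, Multiset.card_map, Multiset.card_range, hdeg])
  rw [← h, chebyshevS_roots_real, Multiset.map_map, Finset.prod_eq_multiset_prod, Finset.range_val]
  rfl

/-- The points `2cos((2k+1)π∕2n)`, `k < n`, are pairwise distinct. [Rivlin §1.2; this file, §1265] -/
theorem chebyshevC_roots_real_nodup (n : ℕ) :
    ((Multiset.range n).map fun k : ℕ => 2 * cos ((2 * k + 1) * π / (2 * n))).Nodup := by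
  have h := (Polynomial.Chebyshev.roots_T_real_nodup n).map (mul_right_injective₀ (two_ne_zero (α := ℝ)))
  rwa [Multiset.map_map] at h

/-- **`(C ℝ n).roots = {2cos((2k+1)π∕2n) : k < n}`** (as a multiset: every root simple). [Rivlin §1.2 with `C_n(2x) = 2T_n(x)`; this file, §1265] -/
theorem chebyshevC_roots_real (n : ℕ) :
    (Polynomial.Chebyshev.C ℝ (n : ℤ)).roots = (Multiset.range n).map fun k : ℕ => 2 * cos ((2 * k + 1) * π / (2 * n)) := by
  classical
  rcases Nat.eq_zero_or_pos n with rfl | hn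
  · rw [Nat.cast_zero, Polynomial.Chebyshev.C_zero, Multiset.range_zero, Multiset.map_zero, show (2 : ℝ[X]) = Polynomial.C 2 from (Polynomial.C_ofNat 2).symm, roots_C]
  have hnd := chebyshevC_roots_real_nodup n
  have hfin : ((Multiset.range n).map fun k : ℕ => 2 * cos ((2 * k + 1) * π / (2 * n))) =
      (((Multiset.range n).map fun k : ℕ => 2 * cos ((2 * k + 1) * π / (2 * n))).toFinset).val := by
    rw [Multiset.toFinset_val, Multiset.dedup_eq_self.mpr hnd]
  rw [hfin]
  refine roots_eq_of_degree_eq_card (fun x hx => ?_) ?_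
  · obtain ⟨k, -, rfl⟩ := Multiset.mem_map.mp (Multiset.mem_toFinset.mp hx)
    have hcos : cos ((2 * (k : ℝ) + 1) * π / 2) = 0 := cos_eq_zero_iff.mpr ⟨k, by push_cast; ring⟩
    have h := Polynomial.Chebyshev.C_two_mul_real_cos ((2 * (k : ℝ) + 1) * π / (2 * (n : ℝ))) (n : ℤ)
    rw [Int.cast_natCast, show (n : ℝ) * ((2 * (k : ℝ) + 1) * π / (2 * (n : ℝ))) = (2 * (k : ℝ) + 1) * π / 2 by field_simp, hcos, mul_zero] at h
    exact h
  · rw [Multiset.card_toFinset, Multiset.dedup_eq_self.mpr hnd, Multiset.card_map, Multiset.card_range]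
    obtain ⟨k, rfl⟩ := Nat.exists_eq_succ_of_ne_zero hn.ne'
    obtain ⟨hmonic, hdeg⟩ := Literature.Algebra.Polynomial.ChebyshevChains.monic_chebyshevC_and_natDegree (R := ℝ) k
    rw [degree_eq_natDegree hmonic.ne_zero, hdeg]

/-- Every real root of `C_n` is simple: `mult(2cos((2k+1)π∕2n), C_n) = 1` (`k < n`). [Rivlin §1.2; this file, §1265] -/
theorem chebyshevC_rootMultiplicity_real {n k : ℕ} (hk : k < n) :
    (Polynomial.Chebyshev.C ℝ (n : ℤ)).rootMultiplicity (2 * cos ((2 * k + 1) * π / (2 * n))) = 1 := by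
  rw [← count_roots, chebyshevC_roots_real]
  exact Multiset.count_eq_one_of_mem (chebyshevC_roots_real_nodup n) (Multiset.mem_map.mpr ⟨k, Multiset.mem_range.mpr hk, rfl⟩)

/-- **Root test: `C_n(x) = 0 ⇔ x = 2cos((2k+1)π∕2n)` for some `k < n`** (`x ∈ ℝ`; both sides are false for `n = 0`, `C_0 = 2`). [Rivlin §1.2; this file, §1265] -/
theorem chebyshevC_eval_eq_zero_iff_real (n : ℕ) (x : ℝ) :
    (Polynomial.Chebyshev.C ℝ (n : ℤ)).eval x = 0 ↔ ∃ k < n, x = 2 * cos ((2 * k + 1) * π / (2 * n)) := by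
  have hne : Polynomial.Chebyshev.C ℝ (n : ℤ) ≠ 0 := by
    rcases Nat.eq_zero_or_pos n with rfl | hn
    · rw [Nat.cast_zero, Polynomial.Chebyshev.C_zero]; exact two_ne_zero
    · obtain ⟨k, rfl⟩ := Nat.exists_eq_succ_of_ne_zero hn.ne'
      exact (Literature.Algebra.Polynomial.ChebyshevChains.monic_chebyshevC_and_natDegree (R := ℝ) k).1.ne_zero
  rw [← Polynomial.IsRoot.def, ← mem_roots hne, chebyshevC_roots_real, Multiset.mem_map]
  constructor
  · rintro ⟨k, hk, rfl⟩; exact ⟨k, Multiset.mem_range.mp hk, rfl⟩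
  · rintro ⟨k, hk, rfl⟩; exact ⟨k, Multiset.mem_range.mpr hk, rfl⟩

/-- **`C_n = ∏_{k<n} (X − 2cos((2k+1)π∕2n))` over `ℝ`** (`n ≠ 0`). [Rivlin §1.2; Szegő (1.12.3); this file, §1265] -/
theorem chebyshevC_eq_prod_real {n : ℕ} (hn : n ≠ 0) :
    Polynomial.Chebyshev.C ℝ (n : ℤ) = ∏ k ∈ Finset.range n, (Polynomial.X - Polynomial.C (2 * cos ((2 * k + 1) * π / (2 * n)))) := by
  obtain ⟨k, rfl⟩ := Nat.exists_eq_succ_of_ne_zero hn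
  obtain ⟨hmonic, hdeg⟩ := Literature.Algebra.Polynomial.ChebyshevChains.monic_chebyshevC_and_natDegree (R := ℝ) k
  have h := prod_multiset_X_sub_C_of_monic_of_roots_card_eq hmonic (by rw [chebyshevC_roots_real, Multiset.card_map, Multiset.card_range, hdeg])
  rw [← h, chebyshevC_roots_real, Multiset.map_map, Finset.prod_eq_multiset_prod, Finset.range_val]
  rfl

end Summit.Ventures.HSemireg.Wedge.HankelOuter
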